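import Mathlib
import Summits.NavierStokesRegularity.NavierStokesRegularity.Theorems.FilamentSkeletonRssAnalyticStripLiaSymbolSeriesExp
import Summits.NavierStokesRegularity.NavierStokesRegularity.Theorems.FilamentSkeletonRssAnalyticStripLiaSymbolExpInt

/-!
# Stub P3 `LiaSymbolBound` — KERNEL-ONLY numerics, brick 3: the NEAR parts (`0 < t ≤ 1`) of `E(p)`, `C(p)` as alternating series
# with the moments `α_j(p) = ∫₀¹ e^{−p/t} t^{j−1} dt` (`α₀ = E₁(p) = Ein p − γ − log p`, recurrence `(j+1)α_{j+1} + p·α_j = e^{−p}`)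

Hand leafhand-ns-filamentskeletonrs-7 g1 (prover), 2026-08-31, `--supports stmt-NavierStokesRegularity-23320 --as helper` (tenure P5-(B)).
Def-free, standard axioms.
* §1 `α_j(p) = ∫_{(0,1]} e^{−p/t} t^j/t`: integrability (`p > 0`), `α₀(p) = E₁(p) = Ein p − γ − log p`
  (tree `…LiaSymbolExpInt` + `Literature…ein_eq_add`), and the recurrence `(j+1)·α_{j+1}(p) + p·α_j(p) = e^{−p}` (FTC for `t^{j+1}e^{−p/t}` on `[0,1]`);
* §2 `near_expansion`: for `p > 0` and all `j, m`,
  `0 ≤ (−1)^m·(∫_{(0,1]} e^{−t}·e^{−p/t}t^j/t − Σ_{i<m} (−1)^i/i!·α_{i+j}(p)) ≤ α_{m+j}(p)/m!`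
  (termwise integration of the alternating Taylor enclosure of `e^{−t}`, brick 1); `j = 0` is the near part of `E`, `j = 1` that of `C`.

HONEST FRAMING: elementary real analysis serving certified numerics for one explicit real integral of a HYPOTHETICAL filament-skeleton line
on the NEGATIVE side of a MODEL route; nothing here bears on Navier–Stokes regularity or blow-up.
-/

set_option linter.dupNamespace false

noncomputable section

namespace Summit.NavierStokesRegularity.NavierStokesRegularity.Theorems.AnalyticStripLiaSymbol

namespace Series

open Real Set MeasureTheory Filter Topology Finset
open Literature.NumberTheory.Sieve

/-! ## §1  The moments `α_j(p) = ∫₀¹ e^{−p/t} t^j/t dt` -/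

/-- Continuity of `e^{−p/t} t^j/t` away from `0`. -/
theorem continuousOn_near (j : ℕ) (p : ℝ) :
    ContinuousOn (fun t : ℝ => Real.exp (-(p / t)) * t ^ j / t) (Ioc 0 1) := by
  intro t ht
  have ht0 : t ≠ 0 := ht.1.ne'
  apply ContinuousAt.continuousWithinAt
  have h3 : ContinuousAt (fun t : ℝ => Real.exp (-(p / t))) t :=
    Real.continuous_exp.continuousAt.comp ((continuousAt_const.div continuousAt_id ht0).neg)
  exact (h3.mul (continuousAt_pow t j)).div continuousAt_id ht0

/-- Pointwise: `0 ≤ e^{−p/t} t^j/t ≤ e^{−p/t}/t ≤ 1/p` on `(0,1]` (`p > 0`). -/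
theorem near_integrand_le (j : ℕ) {p t : ℝ} (hp : 0 < p) (ht : t ∈ Ioc (0:ℝ) 1) :
    0 ≤ Real.exp (-(p / t)) * t ^ j / t ∧ Real.exp (-(p / t)) * t ^ j / t ≤ 1 / p := by
  have ht0 : 0 < t := ht.1
  have hj : t ^ j ≤ 1 := pow_le_one₀ ht0.le ht.2
  refine ⟨by positivity, ?_⟩
  calc Real.exp (-(p / t)) * t ^ j / t ≤ Real.exp (-(p / t)) * 1 / t := by gcongr
    _ = Real.exp (-(p / t)) / t := by rw [mul_one]
    _ ≤ 1 / p := exp_neg_div_div_le hp ht0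

/-- Integrability of `e^{−p/t} t^j/t` on `(0,1]` (`p > 0`). -/
theorem integrableOn_near (j : ℕ) {p : ℝ} (hp : 0 < p) :
    IntegrableOn (fun t : ℝ => Real.exp (-(p / t)) * t ^ j / t) (Ioc 0 1) := by
  refine IntegrableOn.of_bound (by simp) ((continuousOn_near j p).aestronglyMeasurable measurableSet_Ioc) (1 / p) ?_
  rw [ae_restrict_iff' measurableSet_Ioc]
  refine Filter.Eventually.of_forall fun t ht => ?_
  have h := near_integrand_le j hp ht
  rw [Real.norm_eq_abs, abs_of_nonneg h.1]
  exact h.2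

/-- Integrability of the weighted near integrand `e^{−t}·e^{−p/t} t^j/t` on `(0,1]` (`p > 0`). -/
theorem integrableOn_near_weighted (j : ℕ) {p : ℝ} (hp : 0 < p) :
    IntegrableOn (fun t : ℝ => Real.exp (-t) * (Real.exp (-(p / t)) * t ^ j / t)) (Ioc 0 1) := by
  refine IntegrableOn.of_bound (by simp) ?_ (1 / p) ?_
  · exact ((Real.continuous_exp.comp continuous_neg).continuousOn.mul (continuousOn_near j p)).aestronglyMeasurable
      measurableSet_Ioc
  · rw [ae_restrict_iff' measurableSet_Ioc]
    refine Filter.Eventually.of_forall fun t ht => ?_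
    have h := near_integrand_le j hp ht
    have he : Real.exp (-t) ≤ 1 := by rw [Real.exp_le_one_iff]; linarith [ht.1]
    rw [Real.norm_eq_abs, abs_of_nonneg (mul_nonneg (Real.exp_pos _).le h.1)]
    calc Real.exp (-t) * (Real.exp (-(p / t)) * t ^ j / t) ≤ 1 * (1 / p) :=
          mul_le_mul he h.2 h.1 zero_le_one
      _ = 1 / p := one_mul _

/-- `α_j(p) ≥ 0`. -/
theorem alpha_nonneg (j : ℕ) {p : ℝ} (hp : 0 < p) : 0 ≤ ∫ t in Ioc (0:ℝ) 1, Real.exp (-(p / t)) * t ^ j / t :=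
  setIntegral_nonneg measurableSet_Ioc fun _ ht => (near_integrand_le j hp ht).1

/-- **`α₀(p) = E₁(p) = Ein p − γ − log p`** (`p > 0`). -/
theorem alpha_zero {p : ℝ} (hp : 0 < p) :
    ∫ t in Ioc (0:ℝ) 1, Real.exp (-(p / t)) * t ^ 0 / t = ein p - Real.eulerMascheroniConstant - Real.log p := by
  have h1 : ∫ t in Ioc (0:ℝ) 1, Real.exp (-(p / t)) * t ^ 0 / t = ∫ t in Ioc (0:ℝ) 1, Real.exp (-(p / t)) / t :=
    setIntegral_congr_fun measurableSet_Ioc (fun _ _ => by rw [pow_zero, mul_one])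
  rw [h1, integral_Ioc_exp_neg_div_div_eq p, integral_Ioi_exp_neg_mul_div_eq hp]
  have h2 := ein_eq_add hp
  rw [expIntegralE1] at h2
  linarith

/-- **The recurrence** `(j+1)·α_{j+1}(p) + p·α_j(p) = e^{−p}` (`p > 0`): FTC for `t ↦ t^{j+1} e^{−p/t}` on `[0, 1]`. -/
theorem alpha_succ (j : ℕ) {p : ℝ} (hp : 0 < p) :
    ((j:ℝ) + 1) * (∫ t in Ioc (0:ℝ) 1, Real.exp (-(p / t)) * t ^ (j + 1) / t)
      + p * ∫ t in Ioc (0:ℝ) 1, Real.exp (-(p / t)) * t ^ j / t = Real.exp (-p) := by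
  set f : ℝ → ℝ := fun t => t ^ (j + 1) * Real.exp (-(p / t)) with hf
  set f' : ℝ → ℝ := fun t => ((j:ℝ) + 1) * (Real.exp (-(p / t)) * t ^ (j + 1) / t)
    + p * (Real.exp (-(p / t)) * t ^ j / t) with hf'
  have hderiv : ∀ t ∈ Ioo (0:ℝ) 1, HasDerivAt f (f' t) t := by
    intro t ht
    have ht0 : t ≠ 0 := ht.1.ne'
    have h1 : HasDerivAt (fun t : ℝ => -(p / t)) (-((0 * t - p * 1) / t ^ 2)) t :=
      ((hasDerivAt_const t p).div (hasDerivAt_id t) ht0).neg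
    have h2 : HasDerivAt (fun t : ℝ => Real.exp (-(p / t))) (Real.exp (-(p / t)) * -((0 * t - p * 1) / t ^ 2)) t :=
      h1.exp
    refine ((hasDerivAt_pow (j + 1) t).mul h2).congr_deriv ?_
    rw [hf', Nat.add_sub_cancel]
    push_cast
    field_simp
    ring
  have hcont : ContinuousOn f (Icc 0 1) := by
    intro t ht
    rcases eq_or_lt_of_le ht.1 with h0 | hpos
    · -- at `t = 0`: `0 ≤ f s ≤ s^{j+1} → 0 = f 0`
      rw [← h0]
      have hf0 : f 0 = 0 := by simp [hf]
      rw [ContinuousWithinAt, hf0]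
      have hup : Tendsto (fun s : ℝ => s ^ (j + 1)) (𝓝[Icc 0 1] 0) (𝓝 0) := by
        have := ((continuous_pow (j + 1)).tendsto (0:ℝ)).mono_left (nhdsWithin_le_nhds (s := Icc (0:ℝ) 1))
        simpa using this
      refine tendsto_of_tendsto_of_tendsto_of_le_of_le' tendsto_const_nhds hup ?_ ?_
      · filter_upwards [self_mem_nhdsWithin] with s hs
        exact mul_nonneg (pow_nonneg hs.1 _) (Real.exp_pos _).le
      · filter_upwards [self_mem_nhdsWithin] with s hs
        have he : Real.exp (-(p / s)) ≤ 1 := by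
          rw [Real.exp_le_one_iff]; exact neg_nonpos.mpr (div_nonneg hp.le hs.1)
        have hs0 : 0 ≤ s ^ (j + 1) := pow_nonneg hs.1 _
        calc f s = s ^ (j + 1) * Real.exp (-(p / s)) := rfl
          _ ≤ s ^ (j + 1) * 1 := mul_le_mul_of_nonneg_left he hs0
          _ = s ^ (j + 1) := mul_one _
    · apply ContinuousAt.continuousWithinAt
      have hne : t ≠ 0 := hpos.ne'
      exact (continuousAt_pow t (j + 1)).mul
        (Real.continuous_exp.continuousAt.comp ((continuousAt_const.div continuousAt_id hne).neg))
  have hint : IntervalIntegrable f' volume 0 1 := by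
    rw [intervalIntegrable_iff_integrableOn_Ioc_of_le zero_le_one]
    exact ((integrableOn_near (j + 1) hp).const_mul _).add ((integrableOn_near j hp).const_mul _)
  have key := intervalIntegral.integral_eq_sub_of_hasDerivAt_of_le zero_le_one hcont hderiv hint
  rw [intervalIntegral.integral_of_le zero_le_one, hf',
    integral_add ((integrableOn_near (j + 1) hp).const_mul _) ((integrableOn_near j hp).const_mul _),
    integral_const_mul, integral_const_mul] at key
  rw [key, hf]
  simp

/-! ## §2  The near parts as alternating series -/

/-- Algebra of one term: `(−1)^i/i! · (e^{−p/t} t^{i+j}/t) = (e^{−p/t} t^j/t) · ((−t)^i/i!)`. -/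
theorem near_term_eq (j i : ℕ) (p t : ℝ) :
    (-1 : ℝ) ^ i / (i.factorial : ℝ) * (Real.exp (-(p / t)) * t ^ (i + j) / t)
      = (Real.exp (-(p / t)) * t ^ j / t) * ((-t) ^ i / (i.factorial : ℝ)) := by
  rw [neg_pow, pow_add]
  ring

/-- **THE NEAR EXPANSION**: for `p > 0` and all `j m`,
`0 ≤ (−1)^m·(∫_{(0,1]} e^{−t}·(e^{−p/t} t^j/t) dt − Σ_{i<m} (−1)^i/i!·α_{i+j}(p)) ≤ α_{m+j}(p)/m!`. -/
theorem near_expansion (j m : ℕ) {p : ℝ} (hp : 0 < p) :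
    0 ≤ (-1 : ℝ) ^ m * ((∫ t in Ioc (0:ℝ) 1, Real.exp (-t) * (Real.exp (-(p / t)) * t ^ j / t))
        - ∑ i ∈ range m, (-1 : ℝ) ^ i / (i.factorial : ℝ) *
            ∫ t in Ioc (0:ℝ) 1, Real.exp (-(p / t)) * t ^ (i + j) / t) ∧
    (-1 : ℝ) ^ m * ((∫ t in Ioc (0:ℝ) 1, Real.exp (-t) * (Real.exp (-(p / t)) * t ^ j / t))
        - ∑ i ∈ range m, (-1 : ℝ) ^ i / (i.factorial : ℝ) *
            ∫ t in Ioc (0:ℝ) 1, Real.exp (-(p / t)) * t ^ (i + j) / t)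
      ≤ (∫ t in Ioc (0:ℝ) 1, Real.exp (-(p / t)) * t ^ (m + j) / t) / (m.factorial : ℝ) := by
  have hterm : ∀ i ∈ range m, IntegrableOn
      (fun t : ℝ => (-1 : ℝ) ^ i / (i.factorial : ℝ) * (Real.exp (-(p / t)) * t ^ (i + j) / t)) (Ioc 0 1) :=
    fun i _ => (integrableOn_near (i + j) hp).const_mul _
  have hsum : ∑ i ∈ range m, (-1 : ℝ) ^ i / (i.factorial : ℝ) * ∫ t in Ioc (0:ℝ) 1, Real.exp (-(p / t)) * t ^ (i + j) / t
      = ∫ t in Ioc (0:ℝ) 1, ∑ i ∈ range m, (-1 : ℝ) ^ i / (i.factorial : ℝ) * (Real.exp (-(p / t)) * t ^ (i + j) / t) := by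
    rw [integral_finsetSum _ hterm]
    refine sum_congr rfl (fun i _ => ?_)
    rw [integral_const_mul]
  have hsumI : IntegrableOn
      (fun t : ℝ => ∑ i ∈ range m, (-1 : ℝ) ^ i / (i.factorial : ℝ) * (Real.exp (-(p / t)) * t ^ (i + j) / t)) (Ioc 0 1) :=
    integrable_finsetSum _ hterm
  have hG := integrableOn_near_weighted j hp
  have hdiff : (∫ t in Ioc (0:ℝ) 1, Real.exp (-t) * (Real.exp (-(p / t)) * t ^ j / t))
      - ∑ i ∈ range m, (-1 : ℝ) ^ i / (i.factorial : ℝ) * ∫ t in Ioc (0:ℝ) 1, Real.exp (-(p / t)) * t ^ (i + j) / t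
      = ∫ t in Ioc (0:ℝ) 1, (Real.exp (-(p / t)) * t ^ j / t) *
          (Real.exp (-t) - ∑ i ∈ range m, (-t) ^ i / (i.factorial : ℝ)) := by
    rw [hsum, ← integral_sub hG hsumI]
    refine setIntegral_congr_fun measurableSet_Ioc (fun t _ => ?_)
    rw [mul_sub, mul_sum, mul_comm]
    congr 1
    exact sum_congr rfl (fun i _ => near_term_eq j i p t)
  have hRI : IntegrableOn (fun t : ℝ => (Real.exp (-(p / t)) * t ^ j / t) *
      (Real.exp (-t) - ∑ i ∈ range m, (-t) ^ i / (i.factorial : ℝ))) (Ioc 0 1) := by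
    refine (hG.sub hsumI).congr_fun (fun t _ => ?_) measurableSet_Ioc
    simp only [Pi.sub_apply]
    rw [mul_sub, mul_sum, mul_comm]
    congr 1
    exact sum_congr rfl (fun i _ => near_term_eq j i p t)
  rw [hdiff, ← integral_const_mul]
  have hpt : ∀ t ∈ Ioc (0:ℝ) 1,
      0 ≤ (-1 : ℝ) ^ m * ((Real.exp (-(p / t)) * t ^ j / t) *
        (Real.exp (-t) - ∑ i ∈ range m, (-t) ^ i / (i.factorial : ℝ))) ∧
      (-1 : ℝ) ^ m * ((Real.exp (-(p / t)) * t ^ j / t) *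
        (Real.exp (-t) - ∑ i ∈ range m, (-t) ^ i / (i.factorial : ℝ)))
        ≤ (Real.exp (-(p / t)) * t ^ (m + j) / t) / (m.factorial : ℝ) := by
    intro t ht
    have ht0 : 0 < t := ht.1
    have hw := (near_integrand_le j hp ht).1
    have hlo := expTaylor_alternating m t ht0.le
    have habs := abs_exp_neg_sub_taylor_le m ht0.le
    have hup : (-1 : ℝ) ^ m * (Real.exp (-t) - ∑ i ∈ range m, (-t) ^ i / (i.factorial : ℝ))
        ≤ t ^ m / (m.factorial : ℝ) := by
      refine le_trans (le_abs_self _) ?_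
      rw [abs_mul, abs_pow, abs_neg, abs_one, one_pow, one_mul]
      exact habs
    have hpow : t ^ m / (m.factorial : ℝ) * (Real.exp (-(p / t)) * t ^ j / t)
        = (Real.exp (-(p / t)) * t ^ (m + j) / t) / (m.factorial : ℝ) := by
      rw [pow_add]; ring
    constructor
    · have : (-1 : ℝ) ^ m * ((Real.exp (-(p / t)) * t ^ j / t) *
          (Real.exp (-t) - ∑ i ∈ range m, (-t) ^ i / (i.factorial : ℝ)))
          = (Real.exp (-(p / t)) * t ^ j / t) * ((-1 : ℝ) ^ m *
            (Real.exp (-t) - ∑ i ∈ range m, (-t) ^ i / (i.factorial : ℝ))) := by ring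
      rw [this]; exact mul_nonneg hw hlo
    · have : (-1 : ℝ) ^ m * ((Real.exp (-(p / t)) * t ^ j / t) *
          (Real.exp (-t) - ∑ i ∈ range m, (-t) ^ i / (i.factorial : ℝ)))
          = ((-1 : ℝ) ^ m * (Real.exp (-t) - ∑ i ∈ range m, (-t) ^ i / (i.factorial : ℝ)))
            * (Real.exp (-(p / t)) * t ^ j / t) := by ring
      rw [this, ← hpow]
      exact mul_le_mul_of_nonneg_right hup hw
  constructor
  · exact setIntegral_nonneg measurableSet_Ioc fun t ht => (hpt t ht).1
  · have hI2 : IntegrableOn (fun t : ℝ => (Real.exp (-(p / t)) * t ^ (m + j) / t) / (m.factorial : ℝ)) (Ioc 0 1) :=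
      (integrableOn_near (m + j) hp).div_const _
    calc ∫ t in Ioc (0:ℝ) 1, (-1 : ℝ) ^ m * ((Real.exp (-(p / t)) * t ^ j / t) *
          (Real.exp (-t) - ∑ i ∈ range m, (-t) ^ i / (i.factorial : ℝ)))
        ≤ ∫ t in Ioc (0:ℝ) 1, (Real.exp (-(p / t)) * t ^ (m + j) / t) / (m.factorial : ℝ) :=
          setIntegral_mono_on (hRI.const_mul _) hI2 measurableSet_Ioc fun t ht => (hpt t ht).2
      _ = (∫ t in Ioc (0:ℝ) 1, Real.exp (-(p / t)) * t ^ (m + j) / t) / (m.factorial : ℝ) := integral_div _ _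

end Series

end Summit.NavierStokesRegularity.NavierStokesRegularity.Theorems.AnalyticStripLiaSymbol

end
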